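import Literature.IUT.HodgeArakelov.FlSymmetryGenuineTower
import HarnessLib

/-!
# [IUTchII] Rmk. 1.1.1 (i)/(iv): the GENUINE core tower with its core group IDENTIFIED with `Π^tp_C` — cast-free pins
# `Δ_C(M) = Ker(augC)` and `Π_X̲̲(M) ↪ Π_C(M) = inclX` (re-run of abc-iut-w4-d019's p442142 exporting the identification)

Mochizuki, *Inter-universal Teichmüller theory II*, §1, Remark 1.1.1 (i), kurims manuscript (Dec. 2020) pp. 21–22:
«`Π_Y(M) ⊆ Π_X̲(M) ⊆ Π_C(M) (⊇ Π_X(M) ⊇ Π_X̲̲(M))` that are equipped with compatible surjections to `G(M)`. Write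
`Δ_Y(M) ⊆ Δ_X̲(M) ⊆ Δ_C(M) (⊇ Δ_X(M) ⊇ Δ_X̲̲(M))` for the respective kernels»; (iv) p. 23: «`Δ_C(M)/Δ_X̲(M) ≅ 𝔽_l^{⋊±}`»
[claim: Mochizuki2012, status: disputed] (IUTchII §1 Rmk 1.1.1 (i), kurims pp.21-22); [EtTh] §2 p. 36 «`Δ_C := Ker(Π_C ↠ G_K)`»
[cite: MochizukiEtTh2009, Def 2.1 p.36].

Cell abc-iut, seat abc-iut-w4-d018 (gen 7), GAP row **G-w4d018-1**, helper (T). PROOF-ONLY (0 `def` / `instance` /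
`structure`). abc-iut-w4-d019's `ModelFrame.exists_coreTower_flPM_of_cLevelData` (p442142, `FlSymmetryGenuineTower.lean`)
inhabits `CoreTower (F.reconstruction e)` at the genuine [EtTh] frame with `W.PiC = Π^tp_C` and proves the two `W`-clauses of
`FlSymmetry`; its `∃`-statement pins `PiC`, `kerEll`, `Xbar`, `X` (the last two by `HEq`) but NOT the surjection
`projG : Π_C(M) ↠ G(M)` — hence not `Δ_C(M) = Ker(projG)` — nor the embedding `isoXbarbar : Π_X̲̲(M) ≃ Xbarbar ⊆ Π_C(M)`, both of
which the conjugation-action packaging of Rmk. 1.1.1 (iv) (GAP row G-w4d018-1) must read. THIS FILE repeats p442142's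
construction VERBATIM (adapted from `FlSymmetryGenuineTower.lean`; precedent: p442142 itself repeats abc-iut-w5-d225's
p437733 for the same reason) and exports, CAST-FREE, an identification `j : W.PiC ≃* Π^tp_C` (the identity in the
construction) together with:

* `c ∈ Δ_C(M) ↔ augC (j c) = 1` («`Δ_C := Ker(Π_C ↠ G_K)`»);
* `j (isoXbarbar x) = inclX x` for `x ∈ Π^tp_X̲̲ = Π_X̲̲(M)` (the embedding `Π_X(M) ↪ Π_C(M)` IS `Π^tp_X̲̲ ⊆ Π^tp_X ⊆ Π^tp_C`);
* `c ∈ W.Xbar ↔ j c ∈ inclX(Π^tp_X)`, `c ∈ W.X ↔ j c ∈ inclX(toZ⁻¹(l·ℤ))`, `c ∈ W.Y ↔ j c ∈ inclX(Π^tp_X̲̲ ∩ Π^tp_Y)`;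
* the `kerEll` pin and `W.PiC = TopGroup.of Π^tp_C` as in p442142, and the two `W`-clauses
  `(W.DeltaXplain.subgroupOf W.DeltaC).Normal`, `W.DeltaC ⧸ … ≃* 𝔽_l^{⋊±}` (abc-iut-w4-d019's
  `normal_and_nonempty_quotient_mulEquiv_flPM`, p441552).

BINDER CENSUS (BY NAME; no `Prop` fact introduced, no FACT-LIST row consumed): `cl : Mt.CLevelData`, `hO : IsEtThOrigin`,
`hYcl`, the (R1c) clause `hR1c`. HONEST FRAMING: kernel facts about the cell's own typed interfaces; the decoration reading
of Rmk. 1.1.1 (i) (`X := Π_X̲ = inclX(toZ⁻¹(l·ℤ))`) is p437733's; nothing of [IUTchII] is asserted; Rmk. 1.1.1 is outside the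
[IUTchIII] Cor. 3.12 cone; no side taken on Cor. 3.12; typed ≠ proved; witnessed ≠ discharged.
-/

noncomputable section

namespace Literature.IUT.HodgeArakelov

open Literature.AnabelianGeometry.EtaleTheta Literature.AnabelianGeometry.SemiGraphs
open scoped Literature.AnabelianGeometry.EtaleTheta

namespace ModelFrame

variable {p : ℕ} [Fact p.Prime] {Mt : MuTwoSetting p}
  {E : Mt.toThetaSetting.EtaleThetaData} {l : ℕ} (C : E.DoubleUnderline l)
  {S : ThetaSetting.{0}} (μ : Mt.toThetaSetting.CyclotomeMod l S.N)
  (hC : Mt.toThetaSetting.Compat) (hS : Mt.toThetaSetting.Sec2Hyps)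
  (h15 : ThetaSetting.Prop15iii E hC) (L : C.CuspLabels)
  (F : ModelFrame S (C.rigidData μ hC hS h15 L)) {Menv : MonoThetaEnv S}
  (e : Menv.Pi ≃ₜ* (C.rigidData μ hC hS h15 L).env)

/-- **IUTchII:Rmk1.1.1(i)/(iv) — the genuine core tower, with `Π_C(M)` IDENTIFIED with `Π^tp_C`.** Under p442142's
binders (`cl`, `hO`, `hYcl`, `hR1c`) there are a core tower `W` over the Def. 1.1 (i) output of the [EtTh] model frame and
an identification `j : W.PiC ≃* Π^tp_C` such that: `c ∈ Δ_C(M) ↔ augC (j c) = 1`; `j ∘ isoXbarbar = inclX` on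
`Π^tp_X̲̲ = Π_X̲̲(M)`; `W.Xbar`, `W.X`, `W.Y` are `inclX(Π^tp_X)`, `inclX(toZ⁻¹(l·ℤ))`, `inclX(Π^tp_X̲̲ ∩ Π^tp_Y)` read through `j`;
`W.kerEll = Ker(Π^tp_X ↠ (Π^tp_X)^ell) ∩ Π^tp_{Y̲̲}`; `W.PiC = TopGroup.of Π^tp_C`; and the two `W`-clauses of `FlSymmetry`
hold (`Δ_X(M) ⊴ Δ_C(M)`, `Δ_C(M)/Δ_X(M) ≃* 𝔽_l^{⋊±}`). Construction = p442142's, verbatim.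
[claim: Mochizuki2012, status: disputed] (IUTchII §1 Rmk 1.1.1 (i), kurims pp.21-22) -/
theorem exists_coreTower_pinned_of_cLevelData (cl : Mt.CLevelData) (hO : Mt.toThetaSetting.IsEtThOrigin)
    (hYcl : (Mt.DtpY.map Mt.toHat.toMonoidHom).topologicalClosure ≤
      Mt.DtpY.map Mt.toHat.toMonoidHom ⊔ (⁅⁅Mt.DeltaHat, Mt.DeltaHat⁆, Mt.DeltaHat⁆).topologicalClosure)
    (hR1c : ∀ x : Mt.PiTemp, Mt.toZ (cl.conjX Mt.epsPM x) = (Mt.toZ x)⁻¹) :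
    ∃ (W : CoreTower (F.reconstruction e)) (j : W.PiC ≃* Mt.GtpC),
      (∀ c : W.PiC, c ∈ W.DeltaC ↔ cl.augC (j c) = 1) ∧
      (∀ x : ↥C.Huu, j ((W.isoXbarbar x : ↥W.Xbarbar) : W.PiC) = Mt.inclX (x : Mt.PiTemp)) ∧
      (∀ c : W.PiC, c ∈ W.Xbar ↔ j c ∈ Mt.inclX.range) ∧
      (∀ c : W.PiC, c ∈ W.X ↔ j c ∈ ((Subgroup.zpowers (Multiplicative.ofAdd (l : ℤ))).comap Mt.toZ).map Mt.inclX) ∧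
      (∀ c : W.PiC, c ∈ W.Y ↔ j c ∈ (C.Huu ⊓ Mt.GtpY).map Mt.inclX) ∧
      W.kerEll = ((Mt.thetaToEll.comp Mt.toTheta).ker).comap
        (C.Huu.subtype.comp (Mt.GtpY.subgroupOf C.Huu).subtype) ∧
      W.PiC = TopGroup.of Mt.GtpC ∧
      ∃ _hN : (W.DeltaXplain.subgroupOf W.DeltaC).Normal,
        Nonempty (W.DeltaC ⧸ W.DeltaXplain.subgroupOf W.DeltaC ≃* Literature.IUT.HodgeTheaters.FlPM l) := by
  classical
  -- adapted from Literature/IUT/HodgeArakelov/FlSymmetryGenuineTower.lean (abc-iut-w4-d019, p442142), verbatim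
  -- ### notation
  set R : RigidData S.N l := C.rigidData μ hC hS h15 L with hRdef
  have hι : Topology.IsOpenEmbedding Mt.inclX := cl.isOpenEmbedding_inclX
  -- ### `(Δ^tp_{Y̲̲})^ell ≅ Ẑ` (abc-iut-w5-d024, `Discharge/Sec1DeltaYuuEllZHat`)
  obtain ⟨eδ⟩ := C.nonempty_deltaYuuEll_mulEquiv_zHat hO hYcl
  -- ### the open embedding `Π^tp_{X̲̲} ≃ₜ* inclX(Π^tp_{X̲̲})`
  have hmemrange : ∀ y : ↥(C.Huu.map Mt.inclX), (y : Mt.GtpC) ∈ Mt.inclX.range := fun y =>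
    Subgroup.map_le_range _ _ y.2
  have hinv_mem : ∀ y : ↥(C.Huu.map Mt.inclX),
      (MonoidHom.ofInjective Mt.injective_inclX).symm ⟨y, hmemrange y⟩ ∈ C.Huu := by
    intro y
    obtain ⟨x, hx, hxy⟩ := Subgroup.mem_map.1 y.2
    have : (MonoidHom.ofInjective Mt.injective_inclX).symm ⟨y, hmemrange y⟩ = x :=
      Mt.injective_inclX (by rw [MonoidHom.apply_ofInjective_symm]; exact hxy.symm)
    rw [this]; exact hx
  let iX : ↥C.Huu ≃ₜ* ↥(C.Huu.map Mt.inclX) :=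
    { toFun := fun x => ⟨Mt.inclX x, Subgroup.mem_map_of_mem Mt.inclX x.2⟩
      invFun := fun y => ⟨(MonoidHom.ofInjective Mt.injective_inclX).symm ⟨y, hmemrange y⟩, hinv_mem y⟩
      left_inv := fun x => by
        apply Subtype.ext
        apply Mt.injective_inclX
        simp only [MonoidHom.apply_ofInjective_symm]
      right_inv := fun y => by
        apply Subtype.ext
        simp only [MonoidHom.apply_ofInjective_symm]
      map_mul' := fun x y => Subtype.ext (by simp only [Subgroup.coe_mul, map_mul])
      continuous_toFun := (Mt.continuous_inclX.comp continuous_subtype_val).subtype_mk _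
      continuous_invFun := by
        apply Continuous.subtype_mk
        exact cl.continuous_ofInjective_symm.comp (continuous_subtype_val.subtype_mk _) }
  -- ### the surjection `Π^tp_C ↠ G(M) = Π^tp_{X̲̲}/Δ ≅ G_K`
  have haugC_mem : ∀ g : Mt.GtpC, cl.augC g ∈ Mt.GK := fun g => by
    rw [← cl.range_augC]; exact ⟨g, rfl⟩
  let aC : Mt.GtpC →* ↥Mt.GK := cl.augC.toMonoidHom.codRestrict Mt.GK haugC_mem
  have aC_surj : Function.Surjective aC := by
    intro γ
    have hγ : (γ : GQp p) ∈ cl.augC.range := by rw [cl.range_augC]; exact γ.2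
    obtain ⟨g, hg⟩ := hγ
    exact ⟨g, Subtype.ext hg⟩
  let eG : (↥C.Huu ⧸ R.aug.ker) ≃* ↥Mt.GK :=
    QuotientGroup.quotientKerEquivOfSurjective R.aug R.aug_surjective
  have eG_mk : ∀ x : ↥C.Huu, eG (QuotientGroup.mk x) = R.aug x := fun _ => rfl
  let π : Mt.GtpC →* (↥C.Huu ⧸ R.aug.ker) := eG.symm.toMonoidHom.comp aC
  -- ### `Ker(Π_Y(M) ↠ Π^ell_Y(M))` : `Ker(Π^tp_X ↠ (Π^tp_X)^ell)` pulled back to `Π_Y(M) = Π^tp_{Y̲̲}`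
  let K₀ : Subgroup Mt.PiTemp := (Mt.thetaToEll.comp Mt.toTheta).ker
  let kerEll : Subgroup ↥(Mt.GtpY.subgroupOf C.Huu) :=
    K₀.comap (C.Huu.subtype.comp (Mt.GtpY.subgroupOf C.Huu).subtype)
  haveI hK₀n : K₀.Normal := MonoidHom.normal_ker _
  haveI hkn : kerEll.Normal := Subgroup.Normal.comap hK₀n _
  -- ### transport `Δ_Y(M) ≃* Π^tp_{X̲̲} ∩ Δ^tp_Y` (tautological: both are `{x ∈ Π^tp_{X̲̲} ∩ Π^tp_Y | aug x = 1}`)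
  let φ : ↥(F.reconstruction e).DeltaY ≃* ↥(C.Huu ⊓ Mt.DtpY) :=
    { toFun := fun y => ⟨((y.1 : ↥C.Huu) : Mt.PiTemp),
        ⟨(y.1 : ↥C.Huu).2, ⟨Subgroup.mem_subgroupOf.1 y.1.2,
          (mem_deltaY_reconstruction_iff C μ hC hS h15 L F e y.1).1 y.2⟩⟩⟩
      invFun := fun z => ⟨⟨⟨z.1, z.2.1⟩, Subgroup.mem_subgroupOf.2 z.2.2.1⟩,
        (mem_deltaY_reconstruction_iff C μ hC hS h15 L F e _).2 z.2.2.2⟩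
      left_inv := fun _ => rfl
      right_inv := fun _ => rfl
      map_mul' := fun _ _ => rfl }
  have hφ : Subgroup.map (↑φ) (kerEll.subgroupOf (F.reconstruction e).DeltaY) =
      K₀.subgroupOf (C.Huu ⊓ Mt.DtpY) := by
    ext z
    constructor
    · rintro ⟨y, hy, rfl⟩
      exact hy
    · intro hz
      exact ⟨φ.symm z, hz, φ.apply_symm_apply z⟩
  haveI : (K₀.subgroupOf (C.Huu ⊓ Mt.DtpY)).Normal := inferInstance
  haveI : (kerEll.subgroupOf (F.reconstruction e).DeltaY).Normal := inferInstance
  -- ### the two `𝔽_l^{⋊±}`-clauses for `Δ_C(M) := Ker(π)` (under (R1c))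
  have hkerπ : π.ker = cl.augC.toMonoidHom.ker := by
    ext g
    rw [MonoidHom.mem_ker, MonoidHom.mem_ker, MonoidHom.comp_apply, MulEquiv.coe_toMonoidHom,
      MulEquiv.map_eq_one_iff]
    constructor
    · intro h
      have h' := congrArg (fun γ : ↥Mt.GK => (γ : GQp p)) h
      exact h'
    · intro h
      exact Subtype.ext h
  have hflpm := cl.normal_and_nonempty_quotient_mulEquiv_flPM hR1c l π.ker hkerπ
  -- ### the six structural proof obligations of the tower (as in p442142)
  have hXbarbar_le_X : C.Huu.map Mt.inclX ≤
      ((Subgroup.zpowers (Multiplicative.ofAdd (l : ℤ))).comap Mt.toZ).map Mt.inclX := by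
    -- `Π_X̲̲ ⊆ Π_X̲` : `toZ(Π^tp_{X̲̲}) = l·ℤ` ([EtTh] Def. 2.5 (i), `DoubleUnderline.map_toZ_Huu`)
    refine Subgroup.map_mono fun x hx => ?_
    rw [Subgroup.mem_comap, ← C.map_toZ_Huu]
    exact Subgroup.mem_map_of_mem _ hx
  have hisOpen_Y : IsOpen (((C.Huu ⊓ Mt.GtpY).map Mt.inclX : Subgroup Mt.GtpC) : Set Mt.GtpC) := by
    rw [Subgroup.coe_map]
    exact hι.isOpenMap _ (C.isOpen_Huu.inter Mt.toThetaSetting.isOpen_ker_toZ)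
  have hisOpen_X : IsOpen ((((Subgroup.zpowers (Multiplicative.ofAdd (l : ℤ))).comap Mt.toZ).map Mt.inclX :
      Subgroup Mt.GtpC) : Set Mt.GtpC) := by
    -- `Π_X̲` open : it contains the open subgroup `Ker(toZ)`
    rw [Subgroup.coe_map]
    refine hι.isOpenMap _ (Subgroup.isOpen_mono ?_ Mt.toThetaSetting.isOpen_ker_toZ)
    intro x hx
    have hx1 : Mt.toZ x = 1 := hx
    simp only [Subgroup.mem_comap, hx1, one_mem]
  have hisOpen_Xbarbar : IsOpen ((C.Huu.map Mt.inclX : Subgroup Mt.GtpC) : Set Mt.GtpC) := by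
    rw [Subgroup.coe_map]
    exact hι.isOpenMap _ C.isOpen_Huu
  have hisoY : ((F.reconstruction e).inclY.range).map
      (((C.Huu.map Mt.inclX).subtype).comp iX.toMulEquiv.toMonoidHom) = (C.Huu ⊓ Mt.GtpY).map Mt.inclX := by
    -- `isoXbarbar` carries `Π_Y(M) = Π^tp_Y ∩ Π^tp_{X̲̲}` onto `Π_Y = inclX(Π^tp_{X̲̲} ∩ Π^tp_Y)`
    ext g
    constructor
    · intro hg
      obtain ⟨y, hy, hyg⟩ := Subgroup.mem_map.1 hg
      obtain ⟨y', hy'⟩ := MonoidHom.mem_range.1 hy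
      subst hy'
      subst hyg
      exact Subgroup.mem_map.2
        ⟨((y' : ↥C.Huu) : Mt.PiTemp), ⟨(y' : ↥C.Huu).2, Subgroup.mem_subgroupOf.1 y'.2⟩, rfl⟩
    · intro hg
      obtain ⟨x, hx, hxg⟩ := Subgroup.mem_map.1 hg
      subst hxg
      exact Subgroup.mem_map.2 ⟨⟨x, hx.1⟩,
        MonoidHom.mem_range.2 ⟨⟨⟨x, hx.1⟩, Subgroup.mem_subgroupOf.2 hx.2⟩, rfl⟩, rfl⟩
  have hcompat : ∀ x : ↥C.Huu, π ((iX x : ↥(C.Huu.map Mt.inclX)) : Mt.GtpC) = (F.reconstruction e).projG x := by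
    -- compatibility of `Π_C ↠ G(M)` with `Π_X(M) ↠ G(M)` : `augC ∘ inclX = aug`
    intro x
    change eG.symm (aC (Mt.inclX x)) = QuotientGroup.mk x
    rw [MulEquiv.symm_apply_eq, eG_mk]
    apply Subtype.ext
    change cl.augC (Mt.inclX x) = _
    rw [cl.augC_inclX]
    rfl
  -- ### assembly
  let W : CoreTower (F.reconstruction e) :=
    { PiC := TopGroup.of Mt.GtpC
      Y := (C.Huu ⊓ Mt.GtpY).map Mt.inclX
      Xbar := Mt.inclX.range
      X := ((Subgroup.zpowers (Multiplicative.ofAdd (l : ℤ))).comap Mt.toZ).map Mt.inclX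
      Xbarbar := C.Huu.map Mt.inclX
      Y_le_Xbar := Subgroup.map_le_range _ _
      Xbarbar_le_X := hXbarbar_le_X
      Y_le_Xbarbar := Subgroup.map_mono inf_le_left
      isOpen_Y := hisOpen_Y
      isOpen_Xbar := Mt.isOpen_range_inclX
      isOpen_X := hisOpen_X
      isOpen_Xbarbar := hisOpen_Xbarbar
      isoXbarbar := iX
      isoXbarbar_Y := hisoY
      projG := π
      projG_surjective := eG.symm.surjective.comp aC_surj
      projG_compat := hcompat
      kerEll := kerEll
      kerEll_normal := hkn
      deltaEll_iso := ⟨(QuotientGroup.congr _ _ φ hφ).trans eδ⟩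
      deltaEll_normal := inferInstance }
  have hDeltaC : ∀ c : W.PiC, c ∈ W.DeltaC ↔ cl.augC c = 1 := by
    intro c
    change c ∈ π.ker ↔ _
    rw [hkerπ, MonoidHom.mem_ker]
    rfl
  exact ⟨W, MulEquiv.refl _, hDeltaC, fun x => rfl, fun c => Iff.rfl, fun c => Iff.rfl, fun c => Iff.rfl,
    rfl, rfl, hflpm⟩

end ModelFrame

end Literature.IUT.HodgeArakelov

end
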